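import Mathlib
import Summits.Ventures.PercRepro2.LocRows
import Summits.Ventures.PercRepro2.SwRow
import Summits.Ventures.PercRepro2.SwOut
import Summits.Ventures.PercRepro2.SwAllRow
import Summits.Ventures.PercRepro2.SwOutAll
import Summits.Ventures.PercRepro2.SwOutReducible
import Summits.Ventures.PercRepro2.SwOutJunctionH1Defs
import Summits.Ventures.PercRepro2.SwOutMixedPartDefs
import Summits.Ventures.PercRepro2.SwOutMixedPartClass
import Summits.Ventures.PercRepro2.SwOutMixedPartThm
import Summits.Ventures.PercRepro2.SwOutMixedPartSw

/-!
# An instance of Theorem A_mix: the smallest mixed single junction (blind cell PercRepro2,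
night-4 g19, 2026-08-27; proofs/NIGHT4-G19.md §6)

The graph `mixedEx` on `Fin 7` (`l = 0`, `h = 1`, `o = 2`, the junction `u = 3`, its dropped
vertex `p = 4`, the h-piece `y = 5`, the h-arm `x = 6`) with the nine edges `hx, ux, up, py, hy,
xl, pl, yl, ol`: `u` is joined to `h` only through the arm `x` and through `p`–`y`, `p` is the
single vertex of a mixed dropped piece with the dead edge `py` and the outside edge `pl`.  The
simple-arm hypothesis (H1) of Theorem A fails at `p` (not joined to `h`, its component `{p, y}`
meets `N(h)`), and no other single-junction theorem of the tree applies; **row (SW) holds**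
(`sw_mixedEx`) by `sw_of_mixedJunction`.
-/

namespace Summit.Ventures.PercRepro2

namespace BigBlock

open Hull LocRows

open scoped Classical

/-- The smallest mixed single junction: `l = 0`, `h = 1`, `o = 2`, `u = 3`, `p = 4`, `y = 5`,
`x = 6`. -/
def mixedEx : Fin 9 → Sym2 (Fin 7)
  | 0 => s(1, 6) | 1 => s(3, 6) | 2 => s(3, 4) | 3 => s(4, 5) | 4 => s(1, 5)
  | 5 => s(6, 0) | 6 => s(4, 0) | 7 => s(5, 0) | 8 => s(2, 0)

/-- An edge with no end at `c` is not an edge at `c`. -/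
lemma no_edge_at {a b c x : Fin 7} (h : s(a, b) = s(c, x)) (ha : a ≠ c) (hb : b ≠ c) : False := by
  rw [Sym2.eq_iff] at h
  rcases h with ⟨h1, _⟩ | ⟨_, h2⟩
  · exact ha h1
  · exact hb h2

/-- The other end of an edge at `a`. -/
lemma eq_of_edge {a b x : Fin 7} (h : s(a, b) = s(a, x)) (hab : b ≠ a) : x = b := by
  rw [Sym2.eq_iff] at h
  rcases h with ⟨_, h2⟩ | ⟨h1, h2⟩
  · exact h2.symm
  · exact absurd h2 hab

/-- The component of `p = 4` in `G[{0}ᶜ ∖ {1, 3}]` is `{4, 5}`. -/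
lemma mixedEx_compU_subset : compU mixedEx ({0}ᶜ) 1 3 4 ⊆ {4, 5} := by
  intro v hv
  unfold compU at hv
  rw [mem_cluster] at hv
  refine mem_of_conn_of_closed (S := {4, 5}) ?_ (by simp) hv
  intro a ha b hab
  obtain ⟨_, e, he, hends⟩ := openGraph_adj.1 hab
  simp only [decide_eq_true_eq] at he
  obtain ⟨x, hx, y, hy, hxy⟩ := he
  simp only [Set.mem_sdiff, Set.mem_compl_iff, Set.mem_singleton_iff, Set.mem_insert_iff,
    not_or] at hx hy
  simp only [Set.mem_insert_iff, Set.mem_singleton_iff] at ha ⊢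
  fin_cases e <;> simp only [mixedEx] at hxy hends <;> rw [Sym2.eq_iff] at hxy hends <;>
    rcases hxy with ⟨rfl, rfl⟩ | ⟨rfl, rfl⟩ <;> rcases hends with ⟨rfl, rfl⟩ | ⟨rfl, rfl⟩ <;>
    simp_all

/-- The mixed single junction of `mixedEx`. -/
theorem mixedEx_junction : MixedJunction mixedEx ({0}ᶜ) 1 3 4 2 where
  hne_hu := by decide
  hne_hp := by decide
  hne_up := by decide
  hou := by decide
  hop := by decide
  hloop_h := by intro e; fin_cases e <;> decide
  hloop_u := by intro e; fin_cases e <;> decide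
  hloop_p := by intro e; fin_cases e <;> decide
  hnadj := by intro e; fin_cases e <;> decide
  hnadj_p := by intro e; fin_cases e <;> decide
  hup := ⟨2, rfl⟩
  hu_adj_h := by
    intro e x he hx
    fin_cases e <;> simp only [mixedEx] at he
    · exact (no_edge_at he (by decide) (by decide)).elim
    · obtain rfl := eq_of_edge he (by decide)
      exact ⟨0, by decide⟩
    · obtain rfl := eq_of_edge he (by decide)
      exact absurd rfl hx
    · exact (no_edge_at he (by decide) (by decide)).elim
    · exact (no_edge_at he (by decide) (by decide)).elim
    · exact (no_edge_at he (by decide) (by decide)).elim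
    · exact (no_edge_at he (by decide) (by decide)).elim
    · exact (no_edge_at he (by decide) (by decide)).elim
    · exact (no_edge_at he (by decide) (by decide)).elim
  hp_adj_h := by
    intro e x he hxU hx
    fin_cases e <;> simp only [mixedEx] at he
    · exact (no_edge_at he (by decide) (by decide)).elim
    · exact (no_edge_at he (by decide) (by decide)).elim
    · rw [Sym2.eq_swap] at he
      obtain rfl := eq_of_edge he (by decide)
      exact absurd rfl hx
    · obtain rfl := eq_of_edge he (by decide)
      exact ⟨4, by decide⟩
    · exact (no_edge_at he (by decide) (by decide)).elim
    · exact (no_edge_at he (by decide) (by decide)).elim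
    · obtain rfl := eq_of_edge he (by decide)
      exact absurd hxU (by simp)
    · exact (no_edge_at he (by decide) (by decide)).elim
    · exact (no_edge_at he (by decide) (by decide)).elim
  hcomp := by
    intro x hx hxp e he
    have := mixedEx_compU_subset hx
    simp only [Set.mem_insert_iff, Set.mem_singleton_iff] at this
    rcases this with rfl | rfl
    · exact hxp rfl
    · revert he; fin_cases e <;> decide
  hp_nbr := ⟨3, 5, rfl, by simp, by decide⟩
  hout := by
    intro x hx hx1 hx2 hx3
    simp only [Set.mem_compl_iff, Set.mem_singleton_iff] at hx
    fin_cases x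
    · exact absurd rfl hx
    · exact absurd rfl hx1
    · exact absurd rfl hx2
    · exact absurd rfl hx3
    · exact Or.inl ⟨6, 0, rfl, by simp⟩
    · exact Or.inl ⟨7, 0, rfl, by simp⟩
    · exact Or.inl ⟨5, 0, rfl, by simp⟩

/-- **Row (SW) on the smallest mixed single junction.** -/
theorem sw_mixedEx : Sw mixedEx 0 1 2 := by
  refine sw_of_mixedJunction (by decide) mixedEx_junction ?_ ⟨5, ?_⟩
  · intro h2
    have := mixedEx_compU_subset h2
    simp at this
  · intro e x he hxU hx
    fin_cases e <;> simp only [mixedEx] at he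
    · exact (no_edge_at he (by decide) (by decide)).elim
    · exact (no_edge_at he (by decide) (by decide)).elim
    · rw [Sym2.eq_swap] at he
      obtain rfl := eq_of_edge he (by decide)
      exact absurd rfl hx
    · obtain rfl := eq_of_edge he (by decide)
      rfl
    · exact (no_edge_at he (by decide) (by decide)).elim
    · exact (no_edge_at he (by decide) (by decide)).elim
    · obtain rfl := eq_of_edge he (by decide)
      exact absurd hxU (by simp)
    · exact (no_edge_at he (by decide) (by decide)).elim
    · exact (no_edge_at he (by decide) (by decide)).elim

end BigBlock

end Summit.Ventures.PercRepro2
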